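import Mathlib
import HarnessLib
import Literature.MathematicalPhysics.QuantumLattice.KohnLuttinger

/-!
# Route `WeakCouplingBCS` — support item `WcbcsKohnLuttingerB1g` (stmt-HubbardSuperconductivity-0158):
# reduction of the certified-computation claim to `U`-free bounds on the Lindhard form

The item asks for `a < b`, `γ > 0`, `U₁ > 0` with
`channelInf ε μ(δ) U B1g + γ U² ≤ channelInf ε μ(δ) U χ` for all `δ ∈ [a,b]`, `U ∈ (0,U₁)`, `χ ≠ B1g`,
where `ε = squareDispersion 1 0`, `μ(δ) = chemicalPotentialOfDensity ε (1-δ)` and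
`channelInf ε μ U χ = inf {pairingForm ε μ U ψ | ψ normalised, in channel χ}` with the Kohn–Luttinger
kernel `Γ_U(k,k') = U + U² χ₀(k+k')` (`Literature/MathematicalPhysics/QuantumLattice/KohnLuttinger.lean`).

This file proves the STRUCTURAL half of the certificate (the numerical half is an
interval-arithmetic computation attached to the item as compute evidence):

* `pairingForm_eq_first_add_second`: on a Fermi curve of finite density-of-states measure and with
  the Lindhard function bounded on `F + F`, the pairing form splits as
  `⟨ψ, Γ_U ψ⟩ = U (∫ψ dσ)² + U² Q(ψ)`, `Q(ψ) = ∫∫ ψ(k) χ₀(k+k') ψ(k') dσ dσ` (RKS 2010 eq. (7));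
* `sq_mul_le_channelInf`: a lower bound `Λ ≤ Q` on the channel states (`Λ ≤ 0`) gives
  `U² Λ ≤ channelInf` (the first-order term `U (∫ψ)²` is non-negative for repulsive `U ≥ 0`);
* `channelInf_le_sq_mul`: a normalised channel state with `∫ψ dσ = 0` and `Q(ψ) ≤ Λ'` gives
  `channelInf ≤ U² Λ'`;
* `measurable_lindhardFunction`: the Lindhard function of a measurable band is measurable;
* `wcbcsKohnLuttingerB1g_of_certificate`: the item's statement, verbatim, from (i) finiteness of the
  Fermi-curve measure, (ii) a bound on `|χ₀|` on `F + F`, (iii) per-channel lower bounds `Λ χ ≤ Q`,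
  (iv) a mean-zero `B1g` witness with `Q ≤ Λ_B`, (v) the numerical gap `Λ_B + γ ≤ Λ χ ≤ 0` (`χ ≠ B1g`).

References: W. Kohn, J. M. Luttinger, Phys. Rev. Lett. 15 (1965) 524; S. Raghu, S. A. Kivelson,
D. J. Scalapino, Phys. Rev. B 81 (2010) 224505, §II eq. (7), §III Fig. 2.
-/

noncomputable section

-- the tree's namespace `Summit.<Summit>.<Problem>.Theorems` repeats the summit name by design (D-0017)
set_option linter.dupNamespace false

namespace Summit.HubbardSuperconductivity.HubbardSuperconductivity.Theorems

open MeasureTheory Literature.MathematicalPhysics.QuantumLattice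

variable {ε : Momentum → ℝ} {μ : ℝ}

/-! ### Measurability of the Lindhard function -/

/-- The zero-temperature Fermi occupation of a measurable band is measurable. [folklore] -/
theorem measurable_fermiOccupation (hε : Measurable ε) (μ : ℝ) :
    Measurable (fermiOccupation ε μ) := by
  unfold fermiOccupation
  exact Measurable.ite (measurableSet_lt hε measurable_const) measurable_const measurable_const

/-- The zero-temperature Lindhard integrand of a measurable band is jointly measurable in `(q, p)`.
[folklore] -/
theorem measurable_lindhardIntegrand_uncurry (hε : Measurable ε) (μ : ℝ) :
    Measurable (fun z : Momentum × Momentum => lindhardIntegrand ε μ z.1 z.2) := by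
  have hf := measurable_fermiOccupation hε μ
  have h1 : Measurable fun z : Momentum × Momentum => fermiOccupation ε μ z.2 := hf.comp measurable_snd
  have h2 : Measurable fun z : Momentum × Momentum => fermiOccupation ε μ (z.2 + z.1) :=
    hf.comp (measurable_snd.add measurable_fst)
  have h3 : Measurable fun z : Momentum × Momentum => ε (z.2 + z.1) :=
    hε.comp (measurable_snd.add measurable_fst)
  have h4 : Measurable fun z : Momentum × Momentum => ε z.2 := hε.comp measurable_snd
  unfold lindhardIntegrand
  refine Measurable.ite (measurableSet_eq_fun h1 h2) measurable_const ?_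
  exact (h1.sub h2).div (h3.sub h4)

/-- **The static Lindhard function of a measurable band is measurable** (a parametric Bochner
integral of a jointly measurable integrand). [folklore] -/
theorem measurable_lindhardFunction (hε : Measurable ε) (μ : ℝ) :
    Measurable (lindhardFunction ε μ) := by
  have h := (measurable_lindhardIntegrand_uncurry hε μ).stronglyMeasurable.integral_prod_right'
    (ν := (volume : Measure Momentum).restrict brillouinZone)
  have h' : Measurable fun q : Momentum => ∫ p in brillouinZone, lindhardIntegrand ε μ q p :=
    h.measurable
  unfold lindhardFunction
  exact h'.div_const _

/-- The square-lattice dispersion is continuous. [folklore] -/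
theorem continuous_squareDispersion (t t' : ℝ) : Continuous (squareDispersion t t') := by
  unfold squareDispersion
  fun_prop

/-- The square-lattice dispersion is measurable. [folklore] -/
theorem measurable_squareDispersion (t t' : ℝ) : Measurable (squareDispersion t t') :=
  (continuous_squareDispersion t t').measurable

/-! ### The Fermi curve is measurable; the Fermi-curve measure lives on it -/

/-- The Brillouin zone `[-π, π)²` is a measurable set. [folklore] -/
theorem measurableSet_brillouinZone : MeasurableSet brillouinZone := by
  have : brillouinZone = ⋂ i : Fin 2, (fun k : Momentum => k i) ⁻¹' Set.Ico (-Real.pi) Real.pi := by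
    ext k; simp [brillouinZone]
  rw [this]
  refine MeasurableSet.iInter fun i => ?_
  exact measurableSet_Ico.preimage (by fun_prop)

/-- The Fermi curve of a measurable band is a measurable set. [folklore] -/
theorem measurableSet_fermiCurve (hε : Measurable ε) (μ : ℝ) : MeasurableSet (fermiCurve ε μ) :=
  measurableSet_brillouinZone.inter (hε (measurableSet_singleton μ))

/-- The Fermi-curve measure is carried by the Fermi curve. [folklore] -/
theorem ae_mem_fermiCurve (hε : Measurable ε) (μ : ℝ) :
    ∀ᵐ k ∂fermiCurveMeasure ε μ, k ∈ fermiCurve ε μ := by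
  unfold fermiCurveMeasure
  exact (withDensity_absolutelyContinuous _ _).ae_le (ae_restrict_mem (measurableSet_fermiCurve hε μ))

/-! ### Splitting the pairing form -/

/-- The inner integral of the Kohn–Luttinger kernel against an integrable gap function splits into
its first-order (`U ∫ψ`) and second-order (`U² ∫ χ₀(k+k') ψ(k')`) parts, for `k` on the Fermi curve,
when `χ₀` is bounded on `F + F`. [cite: RaghuKivelsonScalapino2010, §II (7)] -/
theorem integral_kohnLuttingerKernel_mul (hε : Measurable ε) (U : ℝ) {C : ℝ} {k : Momentum}
    (hk : k ∈ fermiCurve ε μ) {ψ : Momentum → ℝ} (hψ : Integrable ψ (fermiCurveMeasure ε μ))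
    (hbdd : ∀ k ∈ fermiCurve ε μ, ∀ k' ∈ fermiCurve ε μ, |lindhardFunction ε μ (k + k')| ≤ C) :
    ∫ k', kohnLuttingerKernel ε μ U k k' * ψ k' ∂fermiCurveMeasure ε μ =
      U * ∫ k', ψ k' ∂fermiCurveMeasure ε μ +
        U ^ 2 * ∫ k', lindhardFunction ε μ (k + k') * ψ k' ∂fermiCurveMeasure ε μ := by
  have hint : Integrable (fun k' => lindhardFunction ε μ (k + k') * ψ k') (fermiCurveMeasure ε μ) := by
    refine hψ.bdd_mul (c := C)
      ((measurable_lindhardFunction hε μ).comp (measurable_const_add k)).aestronglyMeasurable ?_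
    filter_upwards [ae_mem_fermiCurve hε μ] with k' hk'
    rw [Real.norm_eq_abs]
    exact hbdd k hk k' hk'
  have hfun : (fun k' => kohnLuttingerKernel ε μ U k k' * ψ k') =
      fun k' => U * ψ k' + U ^ 2 * (lindhardFunction ε μ (k + k') * ψ k') := by
    funext k'
    simp only [kohnLuttingerKernel]
    ring
  rw [hfun, integral_add (hψ.const_mul U) (hint.const_mul _), integral_const_mul, integral_const_mul]

/-- **Splitting of the pairing form** `⟨ψ, Γ_U ψ⟩ = U (∫ψ dσ)² + U² ∫∫ ψ(k) χ₀(k+k') ψ(k') dσ dσ` for a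
square-integrable gap function on a Fermi curve of finite density-of-states measure, when the Lindhard
function is bounded on `F + F`. [cite: RaghuKivelsonScalapino2010, §II (7)] -/
theorem pairingForm_eq_first_add_second (hε : Measurable ε) (U : ℝ) {C : ℝ}
    (hfin : IsFiniteMeasure (fermiCurveMeasure ε μ)) {ψ : Momentum → ℝ}
    (hψ : MemLp ψ 2 (fermiCurveMeasure ε μ))
    (hbdd : ∀ k ∈ fermiCurve ε μ, ∀ k' ∈ fermiCurve ε μ, |lindhardFunction ε μ (k + k')| ≤ C) :
    pairingForm ε μ U ψ =
      U * (∫ k, ψ k ∂fermiCurveMeasure ε μ) ^ 2 +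
        U ^ 2 * ∫ k, ψ k * ∫ k', lindhardFunction ε μ (k + k') * ψ k' ∂fermiCurveMeasure ε μ
          ∂fermiCurveMeasure ε μ := by
  set σ := fermiCurveMeasure ε μ with hσ
  have hψ1 : Integrable ψ σ := hψ.integrable one_le_two
  set g : Momentum → ℝ := fun k => ∫ k', lindhardFunction ε μ (k + k') * ψ k' ∂σ with hg
  -- a.e. on the Fermi curve the inner integral splits
  have hsplit : ∀ᵐ k ∂σ, ψ k * ∫ k', kohnLuttingerKernel ε μ U k k' * ψ k' ∂σ =
      U * (∫ k', ψ k' ∂σ) * ψ k + U ^ 2 * (ψ k * g k) := by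
    filter_upwards [ae_mem_fermiCurve hε μ] with k hk
    rw [integral_kohnLuttingerKernel_mul hε U hk hψ1 hbdd]
    ring
  -- the inner integral is a.e.-strongly measurable and bounded by `C ∫|ψ|` on the Fermi curve
  have hF : AEStronglyMeasurable (fun z : Momentum × Momentum => lindhardFunction ε μ (z.1 + z.2) * ψ z.2)
      (σ.prod σ) :=
    ((measurable_lindhardFunction hε μ).comp measurable_add).aestronglyMeasurable.mul hψ.1.comp_snd
  have hg_meas : AEStronglyMeasurable g σ := hF.integral_prod_right'
  have hg_bdd : ∀ᵐ k ∂σ, ‖g k‖ ≤ C * ∫ k', ‖ψ k'‖ ∂σ := by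
    filter_upwards [ae_mem_fermiCurve hε μ] with k hk
    rw [hg]
    calc ‖∫ k', lindhardFunction ε μ (k + k') * ψ k' ∂σ‖
        ≤ ∫ k', ‖lindhardFunction ε μ (k + k') * ψ k'‖ ∂σ := norm_integral_le_integral_norm _
      _ ≤ ∫ k', C * ‖ψ k'‖ ∂σ := by
          refine integral_mono_ae (hψ1.bdd_mul (c := C)
            ((measurable_lindhardFunction hε μ).comp (measurable_const_add k)).aestronglyMeasurable
            ?_).norm (hψ1.norm.const_mul C) ?_
          · filter_upwards [ae_mem_fermiCurve hε μ] with k' hk'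
            rw [Real.norm_eq_abs]; exact hbdd k hk k' hk'
          · filter_upwards [ae_mem_fermiCurve hε μ] with k' hk'
            rw [norm_mul, Real.norm_eq_abs]
            exact mul_le_mul_of_nonneg_right (hbdd k hk k' hk') (norm_nonneg _)
      _ = C * ∫ k', ‖ψ k'‖ ∂σ := integral_const_mul _ _
  have hψg : Integrable (fun k => ψ k * g k) σ := hψ1.mul_bdd hg_meas hg_bdd
  unfold pairingForm
  rw [integral_congr_ae hsplit, integral_add ((hψ1.const_mul _)) (hψg.const_mul _),
    integral_const_mul, integral_const_mul]
  ring

/-! ### Bounds on the channel infimum -/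

/-- **Lower bound.** If the Lindhard form is `≥ Λ` on the normalised states of a channel, with
`Λ ≤ 0`, then `U² Λ ≤ channelInf` for every repulsive `U ≥ 0` (the first-order term `U (∫ψ)²` is
non-negative; an empty admissible set gives the junk value `0 ≥ U² Λ`).
[cite: RaghuKivelsonScalapino2010, §II (7) and (13)] -/
theorem sq_mul_le_channelInf (hε : Measurable ε) {U C Λ : ℝ} (hU : 0 ≤ U) (χ : D4Irrep)
    (hfin : IsFiniteMeasure (fermiCurveMeasure ε μ))
    (hbdd : ∀ k ∈ fermiCurve ε μ, ∀ k' ∈ fermiCurve ε μ, |lindhardFunction ε μ (k + k')| ≤ C)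
    (hΛ : Λ ≤ 0)
    (hlow : ∀ ψ, IsChannelState ε μ χ ψ →
      Λ ≤ ∫ k, ψ k * ∫ k', lindhardFunction ε μ (k + k') * ψ k' ∂fermiCurveMeasure ε μ
        ∂fermiCurveMeasure ε μ) :
    U ^ 2 * Λ ≤ channelInf ε μ U χ := by
  unfold channelInf
  set S := pairingForm ε μ U '' {ψ | IsChannelState ε μ χ ψ} with hS
  rcases S.eq_empty_or_nonempty with hSe | hSne
  · rw [hSe, Real.sInf_empty]
    exact mul_nonpos_of_nonneg_of_nonpos (sq_nonneg U) hΛ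
  · refine le_csInf hSne ?_
    rintro x ⟨ψ, hψ, rfl⟩
    rw [pairingForm_eq_first_add_second hε U hfin hψ.1 hbdd]
    have h1 : 0 ≤ U * (∫ k, ψ k ∂fermiCurveMeasure ε μ) ^ 2 := mul_nonneg hU (sq_nonneg _)
    have h2 : U ^ 2 * Λ ≤ U ^ 2 * ∫ k, ψ k * ∫ k', lindhardFunction ε μ (k + k') * ψ k'
        ∂fermiCurveMeasure ε μ ∂fermiCurveMeasure ε μ :=
      mul_le_mul_of_nonneg_left (hlow ψ hψ) (sq_nonneg U)
    linarith

/-- **Upper bound.** A normalised channel state with vanishing mean `∫ψ dσ = 0` (automatic by symmetry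
in every channel but `A1g`) and Lindhard form `≤ Λ'` gives `channelInf ≤ U² Λ'`, provided the Lindhard
form is bounded below on the channel (so that the infimum is a genuine one).
[cite: RaghuKivelsonScalapino2010, §II (7) and (13)] -/
theorem channelInf_le_sq_mul (hε : Measurable ε) {U C Λ Λ' : ℝ} (hU : 0 ≤ U) (χ : D4Irrep)
    (hfin : IsFiniteMeasure (fermiCurveMeasure ε μ))
    (hbdd : ∀ k ∈ fermiCurve ε μ, ∀ k' ∈ fermiCurve ε μ, |lindhardFunction ε μ (k + k')| ≤ C)
    (hlow : ∀ ψ, IsChannelState ε μ χ ψ →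
      Λ ≤ ∫ k, ψ k * ∫ k', lindhardFunction ε μ (k + k') * ψ k' ∂fermiCurveMeasure ε μ
        ∂fermiCurveMeasure ε μ)
    (hwit : ∃ ψ, IsChannelState ε μ χ ψ ∧ ∫ k, ψ k ∂fermiCurveMeasure ε μ = 0 ∧
      ∫ k, ψ k * ∫ k', lindhardFunction ε μ (k + k') * ψ k' ∂fermiCurveMeasure ε μ
        ∂fermiCurveMeasure ε μ ≤ Λ') :
    channelInf ε μ U χ ≤ U ^ 2 * Λ' := by
  obtain ⟨ψ, hψ, hmean, hQ⟩ := hwit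
  unfold channelInf
  have hbb : BddBelow (pairingForm ε μ U '' {ψ | IsChannelState ε μ χ ψ}) := by
    refine ⟨U ^ 2 * Λ, ?_⟩
    rintro x ⟨φ, hφ, rfl⟩
    rw [pairingForm_eq_first_add_second hε U hfin hφ.1 hbdd]
    have h1 : 0 ≤ U * (∫ k, φ k ∂fermiCurveMeasure ε μ) ^ 2 := mul_nonneg hU (sq_nonneg _)
    have h2 : U ^ 2 * Λ ≤ U ^ 2 * ∫ k, φ k * ∫ k', lindhardFunction ε μ (k + k') * φ k'
        ∂fermiCurveMeasure ε μ ∂fermiCurveMeasure ε μ :=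
      mul_le_mul_of_nonneg_left (hlow φ hφ) (sq_nonneg U)
    linarith
  calc sInf (pairingForm ε μ U '' {ψ | IsChannelState ε μ χ ψ})
      ≤ pairingForm ε μ U ψ := csInf_le hbb ⟨ψ, hψ, rfl⟩
    _ = U * (∫ k, ψ k ∂fermiCurveMeasure ε μ) ^ 2 +
          U ^ 2 * ∫ k, ψ k * ∫ k', lindhardFunction ε μ (k + k') * ψ k' ∂fermiCurveMeasure ε μ
            ∂fermiCurveMeasure ε μ := pairingForm_eq_first_add_second hε U hfin hψ.1 hbdd
    _ ≤ U ^ 2 * Λ' := by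
          rw [hmean]
          have := mul_le_mul_of_nonneg_left hQ (sq_nonneg U)
          linarith

/-! ### The reduction -/

/-- **Reduction of `WcbcsKohnLuttingerB1g` to a `U`-free certificate.** Write `ε = squareDispersion 1 0`,
`μ_δ = chemicalPotentialOfDensity ε (1 - δ)`, `σ_δ = fermiCurveMeasure ε μ_δ`, `χ₀ = lindhardFunction ε μ_δ`
and `Q_δ(ψ) = ∫∫ ψ(k) χ₀(k + k') ψ(k') dσ_δ dσ_δ`. Suppose that on a doping interval `[a,b] ⊂ (0,1)`:
(i) `σ_δ` is finite; (ii) `|χ₀| ≤ C_δ` on `F_δ + F_δ`; (iii) `Λ_δ χ ≤ Q_δ(ψ)` for every normalised state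
`ψ` of every channel `χ`; (iv) some normalised `B1g` state with `∫ψ dσ_δ = 0` has `Q_δ(ψ) ≤ Λ^B_δ`;
(v) `Λ^B_δ + γ ≤ Λ_δ χ ≤ 0` for `χ ≠ B1g`. Then the route item holds verbatim with these `a, b, γ`
and ANY `U₁ > 0`: `channelInf(B1g) + γ U² ≤ U² Λ^B_δ + γ U² ≤ U² Λ_δ χ ≤ channelInf(χ)`.
Items (iii)–(v) are what the interval-arithmetic certificate of stmt-HubbardSuperconductivity-0158
has to deliver; (i)–(ii) are analytic facts about the `t' = 0` band at `μ ∈ (-4, 0)`.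
[cite: RaghuKivelsonScalapino2010, §III Fig. 2] -/
theorem wcbcsKohnLuttingerB1g_of_certificate {a b γ U₁ : ℝ} {C ΛB : ℝ → ℝ} {Λ : ℝ → D4Irrep → ℝ}
    (ha : 0 < a) (hab : a < b) (hb : b < 1) (hγ : 0 < γ) (hU₁ : 0 < U₁)
    (hfin : ∀ δ ∈ Set.Icc a b, IsFiniteMeasure (fermiCurveMeasure (squareDispersion 1 0)
      (chemicalPotentialOfDensity (squareDispersion 1 0) (1 - δ))))
    (hbdd : ∀ δ ∈ Set.Icc a b,
      ∀ k ∈ fermiCurve (squareDispersion 1 0) (chemicalPotentialOfDensity (squareDispersion 1 0) (1 - δ)),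
      ∀ k' ∈ fermiCurve (squareDispersion 1 0) (chemicalPotentialOfDensity (squareDispersion 1 0) (1 - δ)),
        |lindhardFunction (squareDispersion 1 0)
          (chemicalPotentialOfDensity (squareDispersion 1 0) (1 - δ)) (k + k')| ≤ C δ)
    (hlow : ∀ δ ∈ Set.Icc a b, ∀ χ : D4Irrep, ∀ ψ,
      IsChannelState (squareDispersion 1 0) (chemicalPotentialOfDensity (squareDispersion 1 0) (1 - δ)) χ ψ →
      Λ δ χ ≤ ∫ k, ψ k * ∫ k', lindhardFunction (squareDispersion 1 0)
          (chemicalPotentialOfDensity (squareDispersion 1 0) (1 - δ)) (k + k') * ψ k'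
        ∂fermiCurveMeasure (squareDispersion 1 0) (chemicalPotentialOfDensity (squareDispersion 1 0) (1 - δ))
        ∂fermiCurveMeasure (squareDispersion 1 0) (chemicalPotentialOfDensity (squareDispersion 1 0) (1 - δ)))
    (hwit : ∀ δ ∈ Set.Icc a b, ∃ ψ,
      IsChannelState (squareDispersion 1 0) (chemicalPotentialOfDensity (squareDispersion 1 0) (1 - δ))
        D4Irrep.B1g ψ ∧
      ∫ k, ψ k ∂fermiCurveMeasure (squareDispersion 1 0)
        (chemicalPotentialOfDensity (squareDispersion 1 0) (1 - δ)) = 0 ∧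
      ∫ k, ψ k * ∫ k', lindhardFunction (squareDispersion 1 0)
          (chemicalPotentialOfDensity (squareDispersion 1 0) (1 - δ)) (k + k') * ψ k'
        ∂fermiCurveMeasure (squareDispersion 1 0) (chemicalPotentialOfDensity (squareDispersion 1 0) (1 - δ))
        ∂fermiCurveMeasure (squareDispersion 1 0) (chemicalPotentialOfDensity (squareDispersion 1 0) (1 - δ))
        ≤ ΛB δ)
    (hgap : ∀ δ ∈ Set.Icc a b, ∀ χ : D4Irrep, χ ≠ D4Irrep.B1g → ΛB δ + γ ≤ Λ δ χ)
    (hΛ : ∀ δ ∈ Set.Icc a b, ∀ χ : D4Irrep, χ ≠ D4Irrep.B1g → Λ δ χ ≤ 0) :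
    ∃ a b γ U₁ : ℝ, 0 < a ∧ a < b ∧ b < 1 ∧ 0 < γ ∧ 0 < U₁ ∧ ∀ δ ∈ Set.Icc a b,
      ∀ U ∈ Set.Ioo (0:ℝ) U₁, ∀ χ : Literature.MathematicalPhysics.QuantumLattice.D4Irrep,
        χ ≠ Literature.MathematicalPhysics.QuantumLattice.D4Irrep.B1g →
          Literature.MathematicalPhysics.QuantumLattice.channelInf
              (Literature.MathematicalPhysics.QuantumLattice.squareDispersion 1 0)
              (Literature.MathematicalPhysics.QuantumLattice.chemicalPotentialOfDensity
                (Literature.MathematicalPhysics.QuantumLattice.squareDispersion 1 0) (1 - δ)) U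
              Literature.MathematicalPhysics.QuantumLattice.D4Irrep.B1g + γ * U ^ 2 ≤
            Literature.MathematicalPhysics.QuantumLattice.channelInf
              (Literature.MathematicalPhysics.QuantumLattice.squareDispersion 1 0)
              (Literature.MathematicalPhysics.QuantumLattice.chemicalPotentialOfDensity
                (Literature.MathematicalPhysics.QuantumLattice.squareDispersion 1 0) (1 - δ)) U χ := by
  refine ⟨a, b, γ, U₁, ha, hab, hb, hγ, hU₁, fun δ hδ U hU χ hχ => ?_⟩
  have hε : Measurable (squareDispersion 1 0) := measurable_squareDispersion 1 0
  have hU0 : 0 ≤ U := hU.1.le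
  have hup := channelInf_le_sq_mul hε hU0 D4Irrep.B1g (hfin δ hδ) (hbdd δ hδ) (hlow δ hδ D4Irrep.B1g)
    (hwit δ hδ)
  have hdown := sq_mul_le_channelInf hε hU0 χ (hfin δ hδ) (hbdd δ hδ) (hΛ δ hδ χ hχ) (hlow δ hδ χ)
  have hg := mul_le_mul_of_nonneg_left (hgap δ hδ χ hχ) (sq_nonneg U)
  nlinarith [hup, hdown, hg]

end Summit.HubbardSuperconductivity.HubbardSuperconductivity.Theorems

end
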